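import Literature.AlgebraicGeometry.Resolution.HironakaGroupScheme
import HarnessLib

/-!
# Hironaka's additive group schemes: the exponent condition is monotone

Topic: `Literature/AlgebraicGeometry/Resolution`; sub-namespace `HironakaScheme`.  A consistency check
on the vocabulary of `HironakaGroupScheme.lean` (Oda 1983-II §2, p. 1168): the Frobenius on coefficient
vectors is additive and `p^m`-semilinear (`frobVec_add`, `frobVec_smul`), iterates add up
(`frobVec_frobVec`), it maps spans into spans (`span_image_frobVec_span`), and consequently
**`ExponentLE.mono`**: "exponent `≤ e`" implies "exponent `≤ e'`" for every `e' ≥ e` — as it must for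
Oda's phrase "of exponent not greater than `e`" (`kF^{j−e}Q_e = Q_j` for `j ≥ e` implies the same
with `e'` in place of `e`).  Pub-rosobs cell, Mizutani chain, statement end; AI-written (*AI review is
weaker than expert review*); not a resolution theorem.

References: [Oda1983HironakaGroupSchemeII] §2 (p. 1168).
-/

open MvPolynomial

namespace Literature.AlgebraicGeometry.Resolution.HironakaScheme

universe u

variable {k : Type u} [Field k] {p : ℕ} [Fact p.Prime] [CharP k p] {n : ℕ}

/-- `F^m` is additive on coefficient vectors (characteristic `p`). [cite: Oda1983HironakaGroupSchemeII, §2 (p. 1168: F the p-th power map on L)] -/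
theorem frobVec_add (m : ℕ) (a b : Fin (n + 1) → k) :
    frobVec k p m (a + b) = frobVec k p m a + frobVec k p m b := by
  funext j
  simp only [frobVec, Pi.add_apply]
  exact add_pow_expChar_pow (a j) (b j) p m

omit [Fact p.Prime] [CharP k p] in
/-- `F^m (c • a) = c^{p^m} • F^m a` (`p^m`-semilinearity: `Fa = a^p F` in `k[F]`). [cite: Oda1983HironakaGroupSchemeII, §2 (p. 1168: the twisted polynomial ring k[F], Fa = a^p F)] -/
theorem frobVec_smul (m : ℕ) (c : k) (a : Fin (n + 1) → k) :
    frobVec k p m (c • a) = c ^ p ^ m • frobVec k p m a := by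
  funext j
  simp only [frobVec, Pi.smul_apply, smul_eq_mul, mul_pow]

omit [Fact p.Prime] [CharP k p] in
/-- `F^a ∘ F^b = F^{a+b}`. [cite: Oda1983HironakaGroupSchemeII, §2 (p. 1168)] -/
theorem frobVec_frobVec (a b : ℕ) (v : Fin (n + 1) → k) :
    frobVec k p a (frobVec k p b v) = frobVec k p (b + a) v := by
  funext j
  simp only [frobVec, ← pow_mul, ← pow_add]

/-- `F^m` maps the span of a set into the span of its image, hence
`span (F^m '' span S) = span (F^m '' S)`. [cite: Oda1983HironakaGroupSchemeII, §2 (p. 1168: kF^{j−e}Q_e)] -/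
theorem span_image_frobVec_span (m : ℕ) (S : Set (Fin (n + 1) → k)) :
    Submodule.span k (frobVec k p m '' (Submodule.span k S : Set (Fin (n + 1) → k))) =
      Submodule.span k (frobVec k p m '' S) := by
  apply le_antisymm
  · rw [Submodule.span_le]
    rintro _ ⟨v, hv, rfl⟩
    -- induction on the span membership of `v`
    induction hv using Submodule.span_induction with
    | mem x hx => exact Submodule.subset_span ⟨x, hx, rfl⟩
    | zero =>
      have : frobVec k p m (0 : Fin (n + 1) → k) = 0 := by
        funext j
        simp only [frobVec, Pi.zero_apply]
        exact zero_pow (pow_ne_zero m (Fact.out : p.Prime).ne_zero)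
      rw [this]; exact Submodule.zero_mem _
    | add x y _ _ hx hy => rw [frobVec_add]; exact Submodule.add_mem _ hx hy
    | smul c x _ hx => rw [frobVec_smul]; exact Submodule.smul_mem _ _ hx
  · exact Submodule.span_mono (Set.image_mono Submodule.subset_span)

/-- **Monotonicity of the exponent condition**: `exponent(B(𝔭)) ≤ e` and `e ≤ e'` imply
`exponent(B(𝔭)) ≤ e'` (`Q_j = kF^{j−e}Q_e = kF^{j−e'}(kF^{e'−e}Q_e) = kF^{j−e'}Q_{e'}` for `j ≥ e'`).
[cite: Oda1983HironakaGroupSchemeII, §2 (p. 1168: "of exponent not greater than e")] -/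
theorem ExponentLE.mono {𝔭 : Ideal (MvPolynomial (Fin (n + 1)) k)} {e e' : ℕ}
    (h : ExponentLE k p 𝔭 e) (hee' : e ≤ e') : ExponentLE k p 𝔭 e' := by
  intro j hj
  rw [h e' hee', span_image_frobVec_span, Set.image_image, h j (le_trans hee' hj)]
  congr 1
  refine Set.image_congr' fun v => ?_
  rw [frobVec_frobVec]
  congr 1
  omega

end Literature.AlgebraicGeometry.Resolution.HironakaScheme
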